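import Mathlib.Analysis.SpecialFunctions.Pow.Real
import Mathlib.Analysis.SpecialFunctions.Log.Basic
import Mathlib.Algebra.Order.BigOperators.Group.Finset
import Mathlib.Data.Rat.Cast.Order
import HarnessLib

/-!
# Cell abc-stewartyu, rung A1.L (route `YuMatveevShapeRat`, crux r2 `ArchCoreRat`), parcel WP-L.A P-A4: the SET-UP of the
# ARCHIMEDEAN Gen-3 frame — positive rational generators with a pivot, real logarithms, the linear form `Λ`, the
# `b`-eliminated integer linear forms `𝔛`, the exponent forms `L(λ)`, `E(λ)` and the real slab

`Summits/ABC/StewartYu/ArchG3Setup.lean` — cell `abc-stewartyu` (HOME `run/shared/lean/pub/abc-stewartyu/`; tranche plan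
HOME/plan/POST-M3-TRANCHE-PLAN.md §4′ row P-A4; design of record HOME/p1/memo/ArchG3-START-design-g9.md («design B»);
seat p5-g7).  Plain definitions and theorems; no named fact.  This is the archimedean TWIN of `PadicG3Setup.lean`
(`G3Setup p`, seat p2-g4) with `‖·‖_p ↦ |·|`: the generators are POSITIVE rationals `αⱼ`, their logarithms are the real
numbers `lg j = log αⱼ`, and there is no twist by roots of unity and no slab depth — every function of the sequel
(`ArchG3Functions.lean`) is ENTIRE on `ℂ`.  Symbols follow Nesterenko 2003 §3.5 / §4.2 with the pivot `j₀` in place of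
the printed `n` (the coefficient `b_{j₀} ≠ 0`; the frame chooses it, typically of maximal weight so that
`|𝔛ₖ(λ) log αₖ| ≤ B·L`, (4.22)–(4.23)).  Contents:

* `ArchG3Setup`: `n` positive rationals `αⱼ`, integer coefficients `bⱼ`, the pivot `j₀` with `b j₀ ≠ 0`;
* `lg j = log αⱼ` (`exp (z · lg j) = αⱼ^z`), the linear form `Λ = Σ bⱼ lg j = log ∏ αⱼ^{bⱼ}`;
* the `b`-ELIMINATED INTEGER LINEAR FORMS `𝔛 λ k = b_{j₀} λ_k − b_k λ_{j₀}` (Nesterenko's `𝔛ₖ(λ)`, the eigenvalue of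
  `∂ₖ = b_{j₀} Yₖ ∂/∂Yₖ − bₖ Y_{j₀} ∂/∂Y_{j₀}` on `Y^λ`; `𝔛 λ j₀ = 0`), their linearity, the box bound
  `|𝔛 λ k| ≤ |b_{j₀}| Lₖ + |bₖ| L_{j₀}` (real form), and the rational directional coefficients `zγ λ k = 𝔛 λ k / b_{j₀}`;
* the EXPONENT FORMS `Lsum λ = Σ λⱼ lg j` (`exp (x · Lsum λ) = ∏ αⱼ^{λⱼ x}`, a positive rational at an integer `x`) and
  the `Λ`-free form `E λ = Lsum λ − λ_{j₀} Λ / b_{j₀} = Σ_k zγ λ k · lg k` (the exponent of Nesterenko's `f`, (4.16)–(4.17)),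
  with `|E λ − E λ′| ≤ |Lsum (λ − λ′)| + |λ_{j₀} − λ′_{j₀}|·|Λ / b_{j₀}|`;
* the REAL SLAB property of a finite set of exponent vectors (`IsSlabR w 𝔏 : |Lsum λ − Lsum λ′| ≤ w` on `𝔏` — the
  pigeonhole class of design B replacing Matveev's thin slab `|Σ λⱼ log αⱼ| ≤ L/η` of Prop. 3.4; the pigeonhole itself is
  the START's business), under which relative exponents have `|E(λ − λ′)| ≤ w + |λ_{j₀} − λ′_{j₀}|·|Λ/b_{j₀}|` — the growth
  rate of the class functions on a disc.

WHAT THIS IS NOT: no functions, no Siegel step, no sizes of the weights, no parameters; no crux moves.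

## References
* Yu. V. Nesterenko, *Linear forms in logarithms of rational numbers*, LNM 1819 (2003), §3.5 (p. 68: `∂ₖ`, `𝔛ₖ`),
  Prop. 3.4 (the slab `𝔏`), §4.2 (4.15)–(4.17). [Nesterenko2003]
* E. M. Matveev, Izv. Math. 64 (2000), §3 (the `b`-elimination and the weighted box). [Matveev2000]
-/

noncomputable section

open Finset

namespace Summit.ABC.StewartYu

/-- **The data of the archimedean Gen-3 frame**: `n` positive rationals, integer coefficients and a pivot with a
non-zero coefficient. [cite: Nesterenko2003, §3.5 (p. 68)] -/
structure ArchG3Setup where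
  /-- the number of generators -/
  n : ℕ
  /-- the generators -/
  α : Fin n → ℚ
  /-- they are positive -/
  α_pos : ∀ j, 0 < α j
  /-- the integer coefficients of the linear form -/
  b : Fin n → ℤ
  /-- the pivot -/
  j₀ : Fin n
  /-- its coefficient is non-zero -/
  bj₀_ne : b j₀ ≠ 0

namespace ArchG3Setup

variable (S : ArchG3Setup)

/-! ### The generators and their logarithms -/

/-- `0 < αⱼ` (real). [folklore] -/
theorem α_pos' (j : Fin S.n) : (0 : ℝ) < (S.α j : ℝ) := by exact_mod_cast S.α_pos j

/-- `αⱼ ≠ 0`. [folklore] -/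
theorem α_ne (j : Fin S.n) : S.α j ≠ 0 := (S.α_pos j).ne'

/-- `lg j = log αⱼ`, a real number. [cite: Nesterenko2003, §2 (Theorem 2.2)] -/
def lg (j : Fin S.n) : ℝ := Real.log (S.α j : ℝ)

/-- `exp (lg j) = αⱼ`. [folklore] -/
theorem exp_lg (j : Fin S.n) : Real.exp (S.lg j) = (S.α j : ℝ) := Real.exp_log (S.α_pos' j)

/-- `exp (z · lg j) = αⱼ^z` for an integer `z`. [folklore] -/
theorem exp_intCast_mul_lg (j : Fin S.n) (z : ℤ) : Real.exp ((z : ℝ) * S.lg j) = (S.α j : ℝ) ^ z := by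
  unfold lg
  rw [mul_comm, ← Real.rpow_def_of_pos (S.α_pos' j), Real.rpow_intCast]

/-! ### The coefficients and the pivot -/

/-- `b_{j₀} ≠ 0` in `ℚ`. [folklore] -/
theorem bj₀_ne_rat : (S.b S.j₀ : ℚ) ≠ 0 := by exact_mod_cast S.bj₀_ne

/-- `b_{j₀} ≠ 0` in `ℝ`. [folklore] -/
theorem bj₀_ne_real : (S.b S.j₀ : ℝ) ≠ 0 := by exact_mod_cast S.bj₀_ne

/-- `1 ≤ |b_{j₀}|` (real). [folklore] -/
theorem one_le_abs_bj₀ : (1 : ℝ) ≤ |(S.b S.j₀ : ℝ)| := by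
  have h : (1 : ℤ) ≤ |S.b S.j₀| := Int.one_le_abs S.bj₀_ne
  exact_mod_cast h

/-! ### The linear form -/

/-- The linear form `Λ = Σ bⱼ log αⱼ`. [cite: Nesterenko2003, §2 (2.2)] -/
def Λ : ℝ := ∑ j, (S.b j : ℝ) * S.lg j

/-- `exp Λ = ∏ⱼ αⱼ^{bⱼ}`. [cite: Nesterenko2003, §2 (Lemma 2.3)] -/
theorem exp_Λ : Real.exp S.Λ = ∏ j, (S.α j : ℝ) ^ S.b j := by
  unfold Λ
  rw [Real.exp_sum]
  exact prod_congr rfl fun j _ => S.exp_intCast_mul_lg j (S.b j)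

/-- `0 < ∏ⱼ αⱼ^{eⱼ}` (real). [folklore] -/
theorem prod_zpow_pos (e : Fin S.n → ℤ) : (0 : ℝ) < ∏ j, (S.α j : ℝ) ^ e j :=
  prod_pos fun j _ => zpow_pos (S.α_pos' j) _

/-- `0 < ∏ⱼ αⱼ^{eⱼ}` (rational). [folklore] -/
theorem prod_zpow_pos_rat (e : Fin S.n → ℤ) : (0 : ℚ) < ∏ j, S.α j ^ e j :=
  prod_pos fun j _ => zpow_pos (S.α_pos j) _

/-- `Λ = log ∏ⱼ αⱼ^{bⱼ}`. [cite: Nesterenko2003, §2 (Lemma 2.3)] -/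
theorem Λ_eq_log_prod : S.Λ = Real.log (∏ j, (S.α j : ℝ) ^ S.b j) := by
  rw [← S.exp_Λ, Real.log_exp]

/-! ### The `b`-eliminated integer linear forms -/

/-- **The `b`-eliminated linear forms** `𝔛 λ k = b_{j₀} λ_k − b_k λ_{j₀}` (the eigenvalue of `∂ₖ` on `Y^λ`).
[cite: Nesterenko2003, §3.5 (p. 68)] -/
def 𝔛 (lam : Fin S.n → ℤ) (k : Fin S.n) : ℤ := S.b S.j₀ * lam k - S.b k * lam S.j₀

/-- `𝔛 λ j₀ = 0` (the pivot direction is absent). [cite: Nesterenko2003, §3.5 (p. 68)] -/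
@[simp] theorem 𝔛_pivot (lam : Fin S.n → ℤ) : S.𝔛 lam S.j₀ = 0 := by
  unfold 𝔛; ring

/-- `𝔛 0 = 0`. [folklore] -/
@[simp] theorem 𝔛_zero (k : Fin S.n) : S.𝔛 0 k = 0 := by
  unfold 𝔛; simp

/-- `𝔛` is additive in `λ`. [folklore] -/
theorem 𝔛_add (lam lam' : Fin S.n → ℤ) (k : Fin S.n) : S.𝔛 (lam + lam') k = S.𝔛 lam k + S.𝔛 lam' k := by
  unfold 𝔛; simp only [Pi.add_apply]; ring

/-- `𝔛 (λ − λ′) = 𝔛 λ − 𝔛 λ′`. [folklore] -/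
theorem 𝔛_sub (lam lam' : Fin S.n → ℤ) (k : Fin S.n) : S.𝔛 (lam - lam') k = S.𝔛 lam k - S.𝔛 lam' k := by
  unfold 𝔛; simp only [Pi.sub_apply]; ring

/-- `𝔛 (c • μ) = c · 𝔛 μ`. [folklore] -/
theorem 𝔛_smul (c : ℤ) (mu : Fin S.n → ℤ) (k : Fin S.n) : S.𝔛 (c • mu) k = c * S.𝔛 mu k := by
  unfold 𝔛; simp only [Pi.smul_apply, smul_eq_mul]; ring

/-- **Descent re-indexing**: `𝔛 (λ⁰ + c • μ) k = 𝔛 λ⁰ k + c · 𝔛 μ k`. [cite: Nesterenko2003, §3.5 (3.34), §4 (4.1)] -/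
theorem 𝔛_add_smul (lam0 mu : Fin S.n → ℤ) (c : ℤ) (k : Fin S.n) :
    S.𝔛 (lam0 + c • mu) k = S.𝔛 lam0 k + c * S.𝔛 mu k := by
  rw [S.𝔛_add, S.𝔛_smul]

/-- **The box bound, real form** `|𝔛 λ k| ≤ |b_{j₀}|·L_k + |b_k|·L_{j₀}` when `|λⱼ| ≤ Lⱼ` (the integer form is
`G3Setup.abs_𝔛_le_of_box` of `PadicG3Supply`, same arithmetic). [cite: Nesterenko2003, §3.5 (3.36)] -/
theorem abs_𝔛_real_le_of_box {L : Fin S.n → ℕ} {lam : Fin S.n → ℤ} (hlam : ∀ j, |lam j| ≤ (L j : ℤ)) (k : Fin S.n) :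
    |(S.𝔛 lam k : ℝ)| ≤ |(S.b S.j₀ : ℝ)| * (L k : ℝ) + |(S.b k : ℝ)| * (L S.j₀ : ℝ) := by
  have hk : |(lam k : ℝ)| ≤ (L k : ℝ) := by exact_mod_cast hlam k
  have hj : |(lam S.j₀ : ℝ)| ≤ (L S.j₀ : ℝ) := by exact_mod_cast hlam S.j₀
  unfold 𝔛
  push_cast
  calc |(S.b S.j₀ : ℝ) * lam k - S.b k * lam S.j₀| ≤ |(S.b S.j₀ : ℝ) * lam k| + |(S.b k : ℝ) * lam S.j₀| := abs_sub _ _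
    _ = |(S.b S.j₀ : ℝ)| * |(lam k : ℝ)| + |(S.b k : ℝ)| * |(lam S.j₀ : ℝ)| := by rw [abs_mul, abs_mul]
    _ ≤ |(S.b S.j₀ : ℝ)| * (L k : ℝ) + |(S.b k : ℝ)| * (L S.j₀ : ℝ) :=
        add_le_add (mul_le_mul_of_nonneg_left hk (abs_nonneg _)) (mul_le_mul_of_nonneg_left hj (abs_nonneg _))

/-- The real box bound with a uniform coefficient bound: `|𝔛 λ k| ≤ Bb·(L_k + L_{j₀})` when `|bⱼ| ≤ Bb`, `|λⱼ| ≤ Lⱼ`.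
[cite: Nesterenko2003, §3.5 (3.36)] -/
theorem abs_𝔛_real_le_of_box' {L : Fin S.n → ℕ} {lam : Fin S.n → ℤ} (hlam : ∀ j, |lam j| ≤ (L j : ℤ)) {Bb : ℝ}
    (hb : ∀ j, |(S.b j : ℝ)| ≤ Bb) (k : Fin S.n) : |(S.𝔛 lam k : ℝ)| ≤ Bb * ((L k : ℝ) + (L S.j₀ : ℝ)) := by
  refine (S.abs_𝔛_real_le_of_box hlam k).trans ?_
  have h0 : (0 : ℝ) ≤ L k := Nat.cast_nonneg _
  have h1 : (0 : ℝ) ≤ L S.j₀ := Nat.cast_nonneg _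
  nlinarith [hb S.j₀, hb k, abs_nonneg (S.b S.j₀ : ℝ), abs_nonneg (S.b k : ℝ)]

/-! ### The rational directional coefficients `zγ = 𝔛 / b_{j₀}` -/

/-- `zγ λ k = 𝔛 λ k / b_{j₀}` (Nesterenko's `𝔛ₖ(λ)/bₙ`, a rational number; `zγ λ j₀ = 0`).
[cite: Nesterenko2003, §4.2 (4.17)] -/
def zγ (lam : Fin S.n → ℤ) (k : Fin S.n) : ℚ := (S.𝔛 lam k : ℚ) / (S.b S.j₀ : ℚ)

/-- `zγ λ k = 0` whenever `𝔛 λ k = 0`; in particular in the pivot direction (`𝔛_pivot`). [folklore] -/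
theorem zγ_eq_zero_of_𝔛_eq_zero {lam : Fin S.n → ℤ} {k : Fin S.n} (h : S.𝔛 lam k = 0) : S.zγ lam k = 0 := by
  unfold zγ; rw [h]; simp

/-- `b_{j₀} · zγ λ k = 𝔛 λ k` (so `b_{j₀}^{|t|}` clears `∏ zγ^{t}`). [folklore] -/
theorem bj₀_mul_zγ (lam : Fin S.n → ℤ) (k : Fin S.n) : (S.b S.j₀ : ℚ) * S.zγ lam k = (S.𝔛 lam k : ℚ) := by
  unfold zγ
  field_simp [S.bj₀_ne_rat]

/-- `zγ λ k = λ_k − (b_k / b_{j₀}) λ_{j₀}`. [folklore] -/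
theorem zγ_eq (lam : Fin S.n → ℤ) (k : Fin S.n) :
    S.zγ lam k = (lam k : ℚ) - (S.b k : ℚ) / (S.b S.j₀ : ℚ) * (lam S.j₀ : ℚ) := by
  unfold zγ 𝔛
  push_cast
  field_simp [S.bj₀_ne_rat]

/-- `|zγ λ k| ≤ |𝔛 λ k|` (as `|b_{j₀}| ≥ 1`), in `ℝ`. [folklore] -/
theorem abs_zγ_le_abs_𝔛 (lam : Fin S.n → ℤ) (k : Fin S.n) : |(S.zγ lam k : ℝ)| ≤ |(S.𝔛 lam k : ℝ)| := by
  unfold zγ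
  push_cast
  rw [abs_div]
  exact div_le_self (abs_nonneg _) S.one_le_abs_bj₀

/-- **The box bound for `zγ`**: `|zγ λ k| ≤ L_k + |b_k / b_{j₀}|·L_{j₀}` when `|λⱼ| ≤ Lⱼ`. [cite: Nesterenko2003, §4.2 (4.22)] -/
theorem abs_zγ_le_of_box {L : Fin S.n → ℕ} {lam : Fin S.n → ℤ} (hlam : ∀ j, |lam j| ≤ (L j : ℤ)) (k : Fin S.n) :
    |(S.zγ lam k : ℝ)| ≤ (L k : ℝ) + |(S.b k : ℝ) / (S.b S.j₀ : ℝ)| * (L S.j₀ : ℝ) := by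
  have h := S.zγ_eq lam k
  have hk : |(lam k : ℝ)| ≤ (L k : ℝ) := by exact_mod_cast hlam k
  have hj : |(lam S.j₀ : ℝ)| ≤ (L S.j₀ : ℝ) := by exact_mod_cast hlam S.j₀
  have hcast : (S.zγ lam k : ℝ) = (lam k : ℝ) - (S.b k : ℝ) / (S.b S.j₀ : ℝ) * (lam S.j₀ : ℝ) := by
    rw [h]; push_cast; ring
  rw [hcast]
  calc |(lam k : ℝ) - (S.b k : ℝ) / (S.b S.j₀ : ℝ) * (lam S.j₀ : ℝ)|
      ≤ |(lam k : ℝ)| + |(S.b k : ℝ) / (S.b S.j₀ : ℝ) * (lam S.j₀ : ℝ)| := abs_sub _ _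
    _ = |(lam k : ℝ)| + |(S.b k : ℝ) / (S.b S.j₀ : ℝ)| * |(lam S.j₀ : ℝ)| := by rw [abs_mul]
    _ ≤ (L k : ℝ) + |(S.b k : ℝ) / (S.b S.j₀ : ℝ)| * (L S.j₀ : ℝ) :=
        add_le_add hk (mul_le_mul_of_nonneg_left hj (abs_nonneg _))

/-! ### The exponent forms `L(λ)` and `E(λ)` -/

/-- `Lsum λ = Σⱼ λⱼ log αⱼ` (the exact exponent: `exp (x · Lsum λ) = ∏ αⱼ^{λⱼ x}`). [cite: Nesterenko2003, §4 (4.7)] -/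
def Lsum (lam : Fin S.n → ℤ) : ℝ := ∑ j, (lam j : ℝ) * S.lg j

/-- `Lsum 0 = 0`. [folklore] -/
@[simp] theorem Lsum_zero : S.Lsum 0 = 0 := by
  unfold Lsum; simp

/-- `Lsum λ + Lsum λ′ = Lsum (λ + λ′)`. [folklore] -/
theorem add_Lsum (lam lam' : Fin S.n → ℤ) : S.Lsum lam + S.Lsum lam' = S.Lsum (lam + lam') := by
  unfold Lsum
  rw [← sum_add_distrib]
  refine sum_congr rfl fun j _ => ?_
  simp only [Pi.add_apply, Int.cast_add]; ring

/-- `Lsum (c • μ) = c · Lsum μ`. [folklore] -/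
theorem Lsum_smul (c : ℤ) (mu : Fin S.n → ℤ) : S.Lsum (c • mu) = (c : ℝ) * S.Lsum mu := by
  unfold Lsum
  rw [mul_sum]
  refine sum_congr rfl fun j _ => ?_
  simp only [Pi.smul_apply, smul_eq_mul, Int.cast_mul]; ring

/-- `Lsum λ − Lsum λ′ = Lsum (λ − λ′)` (the slab reads differences of exponents). [folklore] -/
theorem sub_Lsum (lam lam' : Fin S.n → ℤ) : S.Lsum lam - S.Lsum lam' = S.Lsum (lam - lam') := by
  unfold Lsum
  rw [← sum_sub_distrib]
  refine sum_congr rfl fun j _ => ?_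
  simp only [Pi.sub_apply, Int.cast_sub]; ring

/-- `Lsum b = Λ` (the coefficient vector as an exponent vector). [folklore] -/
theorem Lsum_b : S.Lsum S.b = S.Λ := rfl

/-- **The value at an integer point**: `exp (x · Lsum λ) = ∏ⱼ αⱼ^{λⱼ x}`, a positive RATIONAL number (so Siegel's lemma
and Liouville work over `ℚ` with no twist class). [cite: Nesterenko2003, §4 (4.6)–(4.7)] -/
theorem exp_intCast_mul_Lsum (lam : Fin S.n → ℤ) (x : ℤ) :
    Real.exp ((x : ℝ) * S.Lsum lam) = ((∏ j, S.α j ^ (lam j * x) : ℚ) : ℝ) := by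
  unfold Lsum
  rw [mul_sum, Real.exp_sum]
  push_cast
  refine prod_congr rfl fun j _ => ?_
  have : (x : ℝ) * ((lam j : ℝ) * S.lg j) = (((lam j * x : ℤ)) : ℝ) * S.lg j := by push_cast; ring
  rw [this, S.exp_intCast_mul_lg]

/-- **`|Lsum λ| ≤ Σⱼ |λⱼ|·Aⱼ`** when `|log αⱼ| ≤ Aⱼ`. [cite: Nesterenko2003, §2 (proof of Prop. 2.6)] -/
theorem abs_Lsum_le {A : Fin S.n → ℝ} (hA : ∀ j, |S.lg j| ≤ A j) (lam : Fin S.n → ℤ) :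
    |S.Lsum lam| ≤ ∑ j, |(lam j : ℝ)| * A j := by
  unfold Lsum
  refine (abs_sum_le_sum_abs _ _).trans (sum_le_sum fun j _ => ?_)
  rw [abs_mul]
  exact mul_le_mul_of_nonneg_left (hA j) (abs_nonneg _)

/-- `|Lsum λ| ≤ Σⱼ Lⱼ·Aⱼ` on the box `|λⱼ| ≤ Lⱼ` (Matveev's box `Lⱼ = L/(2Aⱼ)` gives `≤ nL/2`).
[cite: Nesterenko2003, §3.4 (proof of Prop. 3.7)] -/
theorem abs_Lsum_le_of_box {A : Fin S.n → ℝ} (hA : ∀ j, |S.lg j| ≤ A j) {L : Fin S.n → ℕ} {lam : Fin S.n → ℤ}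
    (hlam : ∀ j, |lam j| ≤ (L j : ℤ)) : |S.Lsum lam| ≤ ∑ j, (L j : ℝ) * A j := by
  refine (S.abs_Lsum_le hA lam).trans (sum_le_sum fun j _ => ?_)
  have h0 : 0 ≤ A j := (abs_nonneg _).trans (hA j)
  have hj : |(lam j : ℝ)| ≤ (L j : ℝ) := by exact_mod_cast hlam j
  exact mul_le_mul_of_nonneg_right hj h0

/-- **The `Λ`-free exponent** `E λ = Lsum λ − λ_{j₀} · Λ / b_{j₀}` (the exponent of Nesterenko's `f`).
[cite: Nesterenko2003, §4.2 (4.16)–(4.17)] -/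
def E (lam : Fin S.n → ℤ) : ℝ := S.Lsum lam - (lam S.j₀ : ℝ) * S.Λ / (S.b S.j₀ : ℝ)

/-- **`E λ = (b_{j₀})⁻¹ · Σ_k (𝔛 λ k) · log α_k`** — the exponent is a combination of the `b`-eliminated forms.
[cite: Nesterenko2003, §4.2 (4.17), (4.20)] -/
theorem E_eq_sum_𝔛 (lam : Fin S.n → ℤ) :
    S.E lam = (S.b S.j₀ : ℝ)⁻¹ * ∑ k, (S.𝔛 lam k : ℝ) * S.lg k := by
  have hb : (S.b S.j₀ : ℝ) ≠ 0 := S.bj₀_ne_real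
  unfold E Lsum Λ 𝔛
  rw [div_eq_mul_inv]
  have h1 : ∑ k, ((S.b S.j₀ * lam k - S.b k * lam S.j₀ : ℤ) : ℝ) * S.lg k =
      (S.b S.j₀ : ℝ) * ∑ j, (lam j : ℝ) * S.lg j - (lam S.j₀ : ℝ) * ∑ j, (S.b j : ℝ) * S.lg j := by
    rw [mul_sum, mul_sum, ← sum_sub_distrib]
    refine sum_congr rfl fun k _ => ?_
    push_cast; ring
  rw [h1, mul_sub, ← mul_assoc, inv_mul_cancel₀ hb, one_mul]
  congr 1
  field_simp

/-- **`E λ = Σ_k zγ λ k · log α_k`** (so `d/dz exp (E λ · z)` is the sum of the direction bumps with coefficients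
`log α_k`). [cite: Nesterenko2003, §4.2 (4.17), (4.20)] -/
theorem E_eq_sum_zγ (lam : Fin S.n → ℤ) : S.E lam = ∑ k, (S.zγ lam k : ℝ) * S.lg k := by
  rw [S.E_eq_sum_𝔛, mul_sum]
  refine sum_congr rfl fun k _ => ?_
  unfold zγ
  push_cast
  ring

/-- `E 0 = 0`. [folklore] -/
@[simp] theorem E_zero : S.E 0 = 0 := by
  unfold E; simp

/-- `E λ − E λ′ = E (λ − λ′)`. [folklore] -/
theorem sub_E (lam lam' : Fin S.n → ℤ) : S.E lam - S.E lam' = S.E (lam - lam') := by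
  unfold E
  rw [← S.sub_Lsum]
  simp only [Pi.sub_apply, Int.cast_sub]
  ring

/-- `E λ + E λ′ = E (λ + λ′)`. [folklore] -/
theorem add_E (lam lam' : Fin S.n → ℤ) : S.E lam + S.E lam' = S.E (lam + lam') := by
  unfold E
  rw [← S.add_Lsum]
  simp only [Pi.add_apply, Int.cast_add]
  ring

/-- `E λ − Lsum λ = −λ_{j₀} · Λ / b_{j₀}` (the perturbation killed by the smallness of `Λ`).
[cite: Nesterenko2003, §4.2 (4.15)–(4.16)] -/
theorem E_sub_Lsum (lam : Fin S.n → ℤ) : S.E lam - S.Lsum lam = -((lam S.j₀ : ℝ) * (S.Λ / (S.b S.j₀ : ℝ))) := by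
  unfold E; ring

/-- **`|E λ − Lsum λ| = |λ_{j₀}|·|Λ / b_{j₀}|`.** [cite: Nesterenko2003, §4.2 (4.15)] -/
theorem abs_E_sub_Lsum (lam : Fin S.n → ℤ) : |S.E lam - S.Lsum lam| = |(lam S.j₀ : ℝ)| * |S.Λ / (S.b S.j₀ : ℝ)| := by
  rw [S.E_sub_Lsum, abs_neg, abs_mul]

/-- `|E λ| ≤ |Lsum λ| + |λ_{j₀}|·|Λ / b_{j₀}|`. [cite: Nesterenko2003, §4.2 (4.27)] -/
theorem abs_E_le (lam : Fin S.n → ℤ) : |S.E lam| ≤ |S.Lsum lam| + |(lam S.j₀ : ℝ)| * |S.Λ / (S.b S.j₀ : ℝ)| := by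
  have h : S.E lam = S.Lsum lam + (S.E lam - S.Lsum lam) := by ring
  rw [h, ← S.abs_E_sub_Lsum]
  exact abs_add_le _ _

/-- **`|E λ − E λ′| ≤ |Lsum (λ − λ′)| + |λ_{j₀} − λ′_{j₀}|·|Λ / b_{j₀}|`.** [cite: Nesterenko2003, §4.2 (4.27)] -/
theorem abs_E_sub_E_le (lam lam' : Fin S.n → ℤ) :
    |S.E lam - S.E lam'| ≤ |S.Lsum (lam - lam')| + |((lam S.j₀ - lam' S.j₀ : ℤ) : ℝ)| * |S.Λ / (S.b S.j₀ : ℝ)| := by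
  rw [S.sub_E]
  have h := S.abs_E_le (lam - lam')
  simpa only [Pi.sub_apply] using h

/-! ### The real slab (the pigeonhole class of design B) -/

/-- **The real slab property of width `w`** of a finite set of exponent vectors: all `Lsum λ`, `λ ∈ 𝔏`, lie within `w`
of each other.  A pigeonhole over sub-intervals of length `w` of `[−Σ LⱼAⱼ, Σ LⱼAⱼ]` produces such an `𝔏` inside a box
with `#𝔏 ≥ #box / (2⌈Σ LⱼAⱼ / w⌉ + 1)` (the START's business; Nesterenko 2003 Prop. 3.4 has the centred slab
`|Σ λⱼ log αⱼ| ≤ L/η` instead). [folklore] -/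
def IsSlabR (w : ℝ) (𝔏 : Finset (Fin S.n → ℤ)) : Prop :=
  ∀ lam ∈ 𝔏, ∀ lam' ∈ 𝔏, |S.Lsum lam - S.Lsum lam'| ≤ w

/-- The slab property passes to subsets (the descent classes `𝔏_{s+1} ⊆ 𝔏_s`). [folklore] -/
theorem IsSlabR.mono {w : ℝ} {𝔏 𝔏' : Finset (Fin S.n → ℤ)} (h : S.IsSlabR w 𝔏) (h' : 𝔏' ⊆ 𝔏) : S.IsSlabR w 𝔏' :=
  fun lam hl lam' hl' => h lam (h' hl) lam' (h' hl')

/-- The slab property is monotone in the width. [folklore] -/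
theorem IsSlabR.of_le {w w' : ℝ} {𝔏 : Finset (Fin S.n → ℤ)} (h : S.IsSlabR w 𝔏) (hw : w ≤ w') : S.IsSlabR w' 𝔏 :=
  fun lam hl lam' hl' => (h lam hl lam' hl').trans hw

/-- A slab is non-trivial only for `0 ≤ w` (if `𝔏` is non-empty). [folklore] -/
theorem IsSlabR.nonneg {w : ℝ} {𝔏 : Finset (Fin S.n → ℤ)} (h : S.IsSlabR w 𝔏) {lam : Fin S.n → ℤ} (hl : lam ∈ 𝔏) :
    0 ≤ w :=
  (abs_nonneg _).trans (h lam hl lam hl)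

/-- **On a slab of width `w` the relative exponents have `|E(λ − λ′)| ≤ w + |λ_{j₀} − λ′_{j₀}|·|Λ / b_{j₀}|`** — the growth
rate of the class function `z ↦ exp (z · E(λ − λ′))` on a disc (`|exp (z E)| ≤ e^{|z|·|E|}`).
[cite: Nesterenko2003, §4.2 (4.27)] -/
theorem abs_E_sub_le_of_slab {w : ℝ} {𝔏 : Finset (Fin S.n → ℤ)} (h𝔏 : S.IsSlabR w 𝔏) {lam lam' : Fin S.n → ℤ}
    (hl : lam ∈ 𝔏) (hl' : lam' ∈ 𝔏) :
    |S.E (lam - lam')| ≤ w + |((lam S.j₀ - lam' S.j₀ : ℤ) : ℝ)| * |S.Λ / (S.b S.j₀ : ℝ)| := by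
  rw [← S.sub_E]
  refine (S.abs_E_sub_E_le lam lam').trans (add_le_add ?_ le_rfl)
  rw [← S.sub_Lsum]
  exact h𝔏 lam hl lam' hl'

/-- The same with a uniform bound `V₀` for the pivot coordinates of the differences and `δ ≥ |Λ/b_{j₀}|`:
`|E(λ − λ′)| ≤ w + V₀·δ`. [cite: Nesterenko2003, §4.2 (4.27)] -/
theorem abs_E_sub_le_of_slab' {w : ℝ} {𝔏 : Finset (Fin S.n → ℤ)} (h𝔏 : S.IsSlabR w 𝔏) {lam lam' : Fin S.n → ℤ}
    (hl : lam ∈ 𝔏) (hl' : lam' ∈ 𝔏) {V₀ δ : ℝ} (hV₀ : |((lam S.j₀ - lam' S.j₀ : ℤ) : ℝ)| ≤ V₀)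
    (hδ : |S.Λ / (S.b S.j₀ : ℝ)| ≤ δ) : |S.E (lam - lam')| ≤ w + V₀ * δ := by
  refine (S.abs_E_sub_le_of_slab h𝔏 hl hl').trans (add_le_add le_rfl ?_)
  exact mul_le_mul hV₀ hδ (abs_nonneg _) ((abs_nonneg _).trans hV₀)

end ArchG3Setup

end Summit.ABC.StewartYu

end
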